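import Summits.BirchSwinnertonDyer.Rank1Residual.X11b.RingClassFieldConj
import Literature.NumberTheory.EllipticCurves.QuadraticTwistSelmerPInfty
import Literature.NumberTheory.EllipticCurves.HeegnerPointsKolyvaginPairing
import Literature.NumberTheory.EllipticCurves.GeomPointsEmbeddingDescent
import HarnessLib

/-!
# The COUPLED Cassels–Tate telescope, XLIX: REFLECTION IN THE CM FRAME — the lift `τ̃` of complex conjugation
# through the frame transport `κ`, the level embeddings `ιe`, the cubic twists `ψ_X` and the characters `ρ`
# (Gross 1991 Prop. 5.4 (1), `E₉(K̄)`-level half; crux `UpperOffV0HSYPlus`, stmt-BirchSwinnertonDyer-19804;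
# plan (B) SIGNS file B-III (F))

Pure coordinate algebra on the geometric points of `j = 0` curves over a number field `K ∋ ω`, for a lift `τ̃`
(`IsLiftOfAut c τ̃`, `c ω = ω²`) of the conjugation of `K`:
* maps given by a COORDINATE FORMULA `(x, y) ↦ (a x, b y)` (`ψ_X : (v²x, v³y)`, `ρ_g : ((gv/v)²x, y)`,
  `[ζ] : (ζ²x, y)`): `pointsMap_apply_of_formula` (`τ̃ ∘ F = G ∘ τ̃` when `G` has the `τ̃`-conjugate formula),
  `comp_formula`, `eq_of_formula`; cube roots of unity: `pow_three_eq_one_cases`, `lift_apply_of_pow_three_eq_one`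
  (`τ̃ u = u²`);
* the frame transport `κ : (x, y) ↦ (x/36, (y−108)/216)` and the level point maps `ιe = Point.map emb` commute
  with `τ̃` (`pointsMap_apply_of_frameFormula`, `pointsMap_embPoints_eq`), the latter along the restriction
  `τ_m ∈ Aut(K[m]/ℚ) ∖ 𝒢` of `τ̃` (`exists_algEquiv_lift_comp`: `K[m]/ℚ` is Galois);
* (the reflection of the twisted trace itself is the next file `…ReflectionChiComponent`)
* group theory of the twisted trace: `exists_perm_of_transversals`, `bijective_conj_mul_transversal`;
* torsion inside an admissible module is `2^M`-divisible there (`exists_zsmul_eq_of_isOfFinAddOrder_of_admissible`).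
Theorems only (no definition / named fact / instance / notation); nothing asserted on 19804; no stub closed;
X12.CMAtTwo NOT proved; BSD not claimed for any curve.  Sources: [GrossLMS1991] §4 (4.1)–(4.4), §5 Prop. 5.4,
§12 (y_χ); [HuShuYin2019] §1 p. 4, §2 p. 8; [SilvermanAEC2009] III.10.1, VIII.§1.
-/

set_option linter.dupNamespace false -- Summits modules are `Summit.<Summit>.<Problem>…` by design
set_option autoImplicit false

noncomputable section

open scoped Classical

namespace Summit.BirchSwinnertonDyer.BirchSwinnertonDyer.Theorems.SylvesterTwoCMFlip

open WeierstrassCurve Finset NumberField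
open Literature.NumberTheory.EllipticCurves Literature.NumberTheory.EllipticCurves.HuShuYin2019
  Literature.NumberTheory.EllipticCurves.KolyvaginCocycle
  Summit.BirchSwinnertonDyer.Rank1Residual.X11b

variable {K : Type} [Field K] [NumberField K]

/-! ## §1 Maps given by coordinate formulas, and a lift `τ̃` -/

section Formula

variable {c : K ≃ₐ[ℚ] K} {τ : AlgebraicClosure K ≃+* AlgebraicClosure K}
variable {W₁ W₂ W₃ : WeierstrassCurve ℚ}

/-- A formula `(x, y) ↦ (a x, y)` is a formula `(x, y) ↦ (a x, 1·y)`. [folklore] -/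
theorem formula_one_mul {F : geomPoints (W₁.baseChange K) → geomPoints (W₂.baseChange K)} {a : AlgebraicClosure K}
    (hF : ∀ (x y : AlgebraicClosure K)
      (h : ((W₁.baseChange K).baseChange (AlgebraicClosure K)).toAffine.Nonsingular x y),
      ∃ h', F (Affine.Point.some x y h) = Affine.Point.some (a * x) y h') :
    ∀ (x y : AlgebraicClosure K)
      (h : ((W₁.baseChange K).baseChange (AlgebraicClosure K)).toAffine.Nonsingular x y),
      ∃ h', F (Affine.Point.some x y h) = Affine.Point.some (a * x) (1 * y) h' := by
  intro x y h
  obtain ⟨h', e⟩ := hF x y h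
  have h'' : ((W₂.baseChange K).baseChange (AlgebraicClosure K)).toAffine.Nonsingular (a * x) (1 * y) := by
    rwa [one_mul]
  exact ⟨h'', e.trans (Affine.Point.some_eq_some_of_eq rfl (one_mul y).symm)⟩

/-- **`τ̃ ∘ F = G ∘ τ̃`** for maps with formulas `(a x, b y)` and `(τ̃a · x, τ̃b · y)`. [cite: SilvermanAEC2009, III.10.1] -/
theorem pointsMap_apply_of_formula (hτ : IsLiftOfAut c τ)
    {F G : geomPoints (W₁.baseChange K) → geomPoints (W₂.baseChange K)} (hF0 : F 0 = 0) (hG0 : G 0 = 0)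
    {a b a' b' : AlgebraicClosure K}
    (hF : ∀ (x y : AlgebraicClosure K)
      (h : ((W₁.baseChange K).baseChange (AlgebraicClosure K)).toAffine.Nonsingular x y),
      ∃ h', F (Affine.Point.some x y h) = Affine.Point.some (a * x) (b * y) h')
    (hG : ∀ (x y : AlgebraicClosure K)
      (h : ((W₁.baseChange K).baseChange (AlgebraicClosure K)).toAffine.Nonsingular x y),
      ∃ h', G (Affine.Point.some x y h) = Affine.Point.some (a' * x) (b' * y) h')
    (ha : τ a = a') (hb : τ b = b') (Q : geomPoints (W₁.baseChange K)) :
    hτ.pointsMap W₂ (F Q) = G (hτ.pointsMap W₁ Q) := by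
  change ((W₁.baseChange K).baseChange (AlgebraicClosure K)).toAffine.Point at Q
  rcases Q with _ | ⟨x, y, h⟩
  · change hτ.pointsMap W₂ (F 0) = G (hτ.pointsMap W₁ 0)
    rw [hF0, map_zero, map_zero, hG0]
  · obtain ⟨h₁, e₁⟩ := hF x y h
    obtain ⟨h₂, e₂⟩ := hτ.pointsMap_some W₂ h₁
    obtain ⟨h₃, e₃⟩ := hτ.pointsMap_some W₁ h
    obtain ⟨h₄, e₄⟩ := hG (τ x) (τ y) h₃
    refine ((congrArg (hτ.pointsMap W₂) e₁).trans e₂).trans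
      (Eq.symm (((congrArg G e₃).trans e₄).trans ?_))
    exact Affine.Point.some_eq_some_of_eq (by rw [map_mul, ha]) (by rw [map_mul, hb])

/-- Composition of formula maps: `(a'·(a x), b'·(b y))`. [folklore] -/
theorem comp_formula {F : geomPoints (W₁.baseChange K) → geomPoints (W₂.baseChange K)}
    {G : geomPoints (W₂.baseChange K) → geomPoints (W₃.baseChange K)} {a b a' b' : AlgebraicClosure K}
    (hF : ∀ (x y : AlgebraicClosure K)
      (h : ((W₁.baseChange K).baseChange (AlgebraicClosure K)).toAffine.Nonsingular x y),
      ∃ h', F (Affine.Point.some x y h) = Affine.Point.some (a * x) (b * y) h')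
    (hG : ∀ (x y : AlgebraicClosure K)
      (h : ((W₂.baseChange K).baseChange (AlgebraicClosure K)).toAffine.Nonsingular x y),
      ∃ h', G (Affine.Point.some x y h) = Affine.Point.some (a' * x) (b' * y) h') :
    ∀ (x y : AlgebraicClosure K)
      (h : ((W₁.baseChange K).baseChange (AlgebraicClosure K)).toAffine.Nonsingular x y),
      ∃ h', G (F (Affine.Point.some x y h)) = Affine.Point.some (a' * a * x) (b' * b * y) h' := by
  intro x y h
  obtain ⟨h₁, e₁⟩ := hF x y h
  obtain ⟨h₂, e₂⟩ := hG _ _ h₁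
  have h₃ : ((W₃.baseChange K).baseChange (AlgebraicClosure K)).toAffine.Nonsingular (a' * a * x) (b' * b * y) := by
    rw [mul_assoc, mul_assoc]; exact h₂
  exact ⟨h₃, ((congrArg G e₁).trans e₂).trans (Affine.Point.some_eq_some_of_eq (mul_assoc _ _ _).symm
    (mul_assoc _ _ _).symm)⟩

/-- Two maps fixing `0` with the same coordinate formula agree. [folklore] -/
theorem eq_of_formula {F G : geomPoints (W₁.baseChange K) → geomPoints (W₂.baseChange K)}
    (hF0 : F 0 = 0) (hG0 : G 0 = 0) {a b a' b' : AlgebraicClosure K}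
    (hF : ∀ (x y : AlgebraicClosure K)
      (h : ((W₁.baseChange K).baseChange (AlgebraicClosure K)).toAffine.Nonsingular x y),
      ∃ h', F (Affine.Point.some x y h) = Affine.Point.some (a * x) (b * y) h')
    (hG : ∀ (x y : AlgebraicClosure K)
      (h : ((W₁.baseChange K).baseChange (AlgebraicClosure K)).toAffine.Nonsingular x y),
      ∃ h', G (Affine.Point.some x y h) = Affine.Point.some (a' * x) (b' * y) h')
    (ha : a = a') (hb : b = b') (Q : geomPoints (W₁.baseChange K)) : F Q = G Q := by
  change ((W₁.baseChange K).baseChange (AlgebraicClosure K)).toAffine.Point at Q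
  rcases Q with _ | ⟨x, y, h⟩
  · change F 0 = G 0
    rw [hF0, hG0]
  · obtain ⟨h₁, e₁⟩ := hF x y h
    obtain ⟨h₂, e₂⟩ := hG x y h
    exact e₁.trans ((Affine.Point.some_eq_some_of_eq (by rw [ha]) (by rw [hb])).trans e₂.symm)

/-- **The frame transport `κ : (x, y) ↦ (x/36, (y−108)/216)` commutes with `τ̃`** (its formula is `ℚ`-rational).
[cite: HuShuYin2019, §2 p. 8] -/
theorem pointsMap_apply_of_frameFormula (hτ : IsLiftOfAut c τ)
    {κ : geomPoints (W₁.baseChange K) → geomPoints (W₂.baseChange K)} (hκ0 : κ 0 = 0)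
    (hκ : ∀ {x y : AlgebraicClosure K}
      (h : ((W₁.baseChange K).baseChange (AlgebraicClosure K)).toAffine.Nonsingular x y),
      ∃ h', κ (Affine.Point.some x y h) = Affine.Point.some (x / 36) ((y - 108) / 216) h')
    (Q : geomPoints (W₁.baseChange K)) :
    hτ.pointsMap W₂ (κ Q) = κ (hτ.pointsMap W₁ Q) := by
  change ((W₁.baseChange K).baseChange (AlgebraicClosure K)).toAffine.Point at Q
  rcases Q with _ | ⟨x, y, h⟩
  · change hτ.pointsMap W₂ (κ 0) = κ (hτ.pointsMap W₁ 0)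
    rw [hκ0, map_zero, map_zero, hκ0]
  · obtain ⟨h₁, e₁⟩ := hκ h
    obtain ⟨h₂, e₂⟩ := hτ.pointsMap_some W₂ h₁
    obtain ⟨h₃, e₃⟩ := hτ.pointsMap_some W₁ h
    obtain ⟨h₄, e₄⟩ := hκ h₃
    refine ((congrArg (hτ.pointsMap W₂) e₁).trans e₂).trans (Eq.symm (((congrArg κ e₃).trans e₄).trans ?_))
    refine Affine.Point.some_eq_some_of_eq ?_ ?_
    · rw [map_div₀, map_ofNat]
    · rw [map_div₀, map_sub, map_ofNat, map_ofNat]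

/-- **The level point map `ιe = Point.map emb` intertwines `τ̃` with its restriction `τ_L`**:
`τ̃ • ιe P = ιe (τ_L P)` when `τ̃ ∘ emb = emb ∘ τ_L`. [cite: GrossLMS1991, §4 (4.2), §5] -/
theorem pointsMap_embPoints_eq (hτ : IsLiftOfAut c τ) {L : Type} [Field L] [CharZero L]
    (emb : L →+* AlgebraicClosure K)
    (ιe : letI : DecidableEq L := fun a b ↦ Classical.propDecidable (a = b)
      (W₁.baseChange L).toAffine.Point →+ geomPoints (W₁.baseChange K))
    (hιe : ∀ P, ιe P = Affine.Point.map (W' := W₁) emb.toRatAlgHom P)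
    (τL : L ≃ₐ[ℚ] L) (hcomp : ∀ x : L, τ (emb x) = emb (τL x))
    (P : letI : DecidableEq L := fun a b ↦ Classical.propDecidable (a = b); (W₁.baseChange L).toAffine.Point) :
    hτ.pointsMap W₁ (ιe P) =
      ιe (letI : DecidableEq L := fun a b ↦ Classical.propDecidable (a = b); pointGalHom W₁ L τL P) := by
  letI : DecidableEq L := fun a b ↦ Classical.propDecidable (a = b)
  rw [← map_toRatAlgHom_eq_pointGalHom]
  rcases P with _ | ⟨x, y, h⟩
  · change hτ.pointsMap W₁ (ιe 0) = ιe (Affine.Point.map (W' := W₁) (τL : L →+* L).toRatAlgHom 0)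
    simp only [map_zero]
  · rw [hιe, hιe]
    obtain ⟨h₁, e₁⟩ : ∃ h₁, Affine.Point.map (W' := W₁) emb.toRatAlgHom (Affine.Point.some x y h) =
        (show geomPoints (W₁.baseChange K) from Affine.Point.some (emb x) (emb y) h₁) := ⟨_, rfl⟩
    obtain ⟨h₂, e₂⟩ := hτ.pointsMap_some W₁ h₁
    obtain ⟨h₃, e₃⟩ : ∃ h₃, Affine.Point.map (W' := W₁) (τL : L →+* L).toRatAlgHom (Affine.Point.some x y h) =
        Affine.Point.some (τL x) (τL y) h₃ := ⟨_, rfl⟩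
    obtain ⟨h₄, e₄⟩ : ∃ h₄, Affine.Point.map (W' := W₁) emb.toRatAlgHom (Affine.Point.some (τL x) (τL y) h₃) =
        (show geomPoints (W₁.baseChange K) from Affine.Point.some (emb (τL x)) (emb (τL y)) h₄) := ⟨_, rfl⟩
    rw [e₁, e₂, e₃, e₄]
    exact Affine.Point.some_eq_some_of_eq (hcomp x) (hcomp y)

/-- A cube root of unity in `K̄` is `1`, `ω̄` or `ω̄²` (`X³ − 1 = (X − 1)(X − ω̄)(X − ω̄²)`). [folklore] -/
theorem pow_three_eq_one_cases {ω : K} (hω : ω ^ 2 + ω + 1 = 0) {u : AlgebraicClosure K} (hu : u ^ 3 = 1) :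
    u = 1 ∨ u = algebraMap K (AlgebraicClosure K) ω ∨ u = algebraMap K (AlgebraicClosure K) ω ^ 2 := by
  set ω' := algebraMap K (AlgebraicClosure K) ω with hω'
  have hω'2 : ω' ^ 2 + ω' + 1 = 0 := by
    rw [hω', ← map_pow, ← map_add, ← map_one (algebraMap K (AlgebraicClosure K)), ← map_add, hω, map_zero]
  have hfac : (u - 1) * (u - ω') * (u - ω' ^ 2) = 0 := by
    have : (u - 1) * (u - ω') * (u - ω' ^ 2) =
        u ^ 3 - 1 - (ω' ^ 2 + ω' + 1) * u ^ 2 + (ω' ^ 2 + ω' + 1) * ω' * u - (ω' ^ 2 + ω' + 1) * (ω' - 1) := by ring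
    rw [this, hω'2, hu]; ring
  rcases mul_eq_zero.mp hfac with h12 | h3
  · rcases mul_eq_zero.mp h12 with h1 | h2
    · exact Or.inl (sub_eq_zero.mp h1)
    · exact Or.inr (Or.inl (sub_eq_zero.mp h2))
  · exact Or.inr (Or.inr (sub_eq_zero.mp h3))

/-- **`τ̃ u = u²` for every cube root of unity `u ∈ K̄`** when `τ̃` lifts `c` with `c ω = ω²`. [folklore] -/
theorem lift_apply_of_pow_three_eq_one (hτ : IsLiftOfAut c τ) {ω : K} (hω : ω ^ 2 + ω + 1 = 0)
    (hcω : c ω = ω ^ 2) {u : AlgebraicClosure K} (hu : u ^ 3 = 1) : τ u = u ^ 2 := by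
  have hτω : τ (algebraMap K (AlgebraicClosure K) ω) = algebraMap K (AlgebraicClosure K) ω ^ 2 := by
    rw [hτ, hcω, map_pow]
  rcases pow_three_eq_one_cases hω hu with rfl | rfl | rfl
  · rw [map_one, one_pow]
  · exact hτω
  · rw [map_pow, hτω]

/-- **The restriction `τ_m ∈ Aut(K[m]/ℚ)` of a lift `τ̃` along an embedding `emb : K[m] → K̄` over `K`**:
`τ̃ ∘ emb = emb ∘ τ_m` (`K[m]/ℚ` is Galois, Cox Lemma 9.3), and `τ_m ∉ 𝒢 = Gal(K[m]/K)` (it restricts to `c ≠ 1`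
on `K`). [cite: Cox2013, §9.A Lemma 9.3] [cite: GrossLMS1991, §3 (p. 238)] -/
theorem exists_algEquiv_lift_comp (hK : IsImaginaryQuadratic K) (ι : K →+* ℂ) {m : ℕ} (hm : m ≠ 0)
    (emb : ringClassField K ι m →+* AlgebraicClosure K)
    (hemb : ∀ k : K, emb (algebraMap K (ringClassField K ι m) k) = algebraMap K (AlgebraicClosure K) k)
    (hτ : IsLiftOfAut c τ) (hc : c ≠ 1) :
    ∃ τL : ringClassField K ι m ≃ₐ[ℚ] ringClassField K ι m,
      (∀ x, τ (emb x) = emb (τL x)) ∧ τL ∉ ringClassGal ι m := by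
  haveI := RingClassConj.isGalois_rat_ringClassField hK ι hm
  letI : Algebra (ringClassField K ι m) (AlgebraicClosure K) := emb.toAlgebra
  haveI : IsScalarTower ℚ (ringClassField K ι m) (AlgebraicClosure K) :=
    IsScalarTower.of_algebraMap_eq fun x ↦ by
      change (algebraMap ℚ (AlgebraicClosure K)) x = emb (algebraMap ℚ (ringClassField K ι m) x)
      rw [eq_ratCast, eq_ratCast, map_ratCast]
  refine ⟨hτ.algEquiv.restrictNormal (ringClassField K ι m), fun x ↦ ?_, fun hmem ↦ hc ?_⟩
  · have h := AlgEquiv.restrictNormal_commutes hτ.algEquiv (ringClassField K ι m) x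
    rw [IsLiftOfAut.algEquiv_apply] at h
    exact h.symm
  · ext k
    have h1 := AlgEquiv.restrictNormal_commutes hτ.algEquiv (ringClassField K ι m)
      (algebraMap K (ringClassField K ι m) k)
    rw [smul_algebraMap_of_mem_ringClassGal hmem k, IsLiftOfAut.algEquiv_apply] at h1
    change emb (algebraMap K _ k) = τ (emb (algebraMap K _ k)) at h1
    rw [hemb, hτ] at h1
    exact ((algebraMap K (AlgebraicClosure K)).injective h1).symm

end Formula

/-! ## §2 Transversals, and torsion in an admissible module -/

section Group

/-- Two transversals of `G/N` differ by a permutation and elements of `N`. [cite: GrossLMS1991, §12 (y_χ)] -/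
theorem exists_perm_of_transversals {G : Type*} [Group G] (N : Subgroup G) {ι : Type*} (t s : ι → G)
    (ht : Function.Bijective fun i ↦ (t i : G ⧸ N)) (hs : Function.Bijective fun i ↦ (s i : G ⧸ N)) :
    ∃ π : ι ≃ ι, ∀ i, ∃ h ∈ N, s i = t (π i) * h := by
  let et : ι ≃ G ⧸ N := Equiv.ofBijective _ ht
  let es : ι ≃ G ⧸ N := Equiv.ofBijective _ hs
  refine ⟨es.trans et.symm, fun i ↦ ⟨(t (et.symm (es i)))⁻¹ * s i, ?_, ?_⟩⟩
  · rw [← QuotientGroup.eq]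
    have h1 : (t (et.symm (es i)) : G ⧸ N) = et (et.symm (es i)) := rfl
    rw [h1, Equiv.apply_symm_apply]
    rfl
  · show s i = t (et.symm (es i)) * ((t (et.symm (es i)))⁻¹ * s i)
    rw [mul_inv_cancel_left]

/-- **Conjugating a transversal by an `N`-preserving involution and translating it is again a transversal**
(`N` normal): `i ↦ φ(t_i) σ` is bijective onto `G/N`. [cite: GrossLMS1991, §5 (proof of Prop. 5.4)] -/
theorem bijective_conj_mul_transversal {G : Type*} [Group G] (N : Subgroup G) [N.Normal] {ι : Type*} [Finite ι]
    (t : ι → G) (ht : Function.Bijective fun i ↦ (t i : G ⧸ N)) (φ : G →* G) (hφ : ∀ g, φ (φ g) = g)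
    (hφN : ∀ h ∈ N, φ h ∈ N) (σ : G) :
    Function.Bijective fun i ↦ ((φ (t i) * σ : G) : G ⧸ N) := by
  let e : ι ≃ G ⧸ N := Equiv.ofBijective _ ht
  -- injectivity
  have hinj : Function.Injective fun i ↦ ((φ (t i) * σ : G) : G ⧸ N) := by
    intro i j hij
    have h1 : (φ (t i) * σ)⁻¹ * (φ (t j) * σ) ∈ N := QuotientGroup.eq.mp hij
    have h2 : σ⁻¹ * ((φ (t i))⁻¹ * φ (t j)) * σ ∈ N := by
      have : (φ (t i) * σ)⁻¹ * (φ (t j) * σ) = σ⁻¹ * ((φ (t i))⁻¹ * φ (t j)) * σ := by group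
      rwa [this] at h1
    have h3 : (φ (t i))⁻¹ * φ (t j) ∈ N := by
      have := Subgroup.Normal.conj_mem inferInstance _ h2 σ
      rwa [show σ * (σ⁻¹ * ((φ (t i))⁻¹ * φ (t j)) * σ) * σ⁻¹ = (φ (t i))⁻¹ * φ (t j) by group] at this
    have h4 : (t i)⁻¹ * t j ∈ N := by
      have := hφN _ h3
      rwa [map_mul, map_inv, hφ, hφ] at this
    exact ht.1 (QuotientGroup.eq.mpr h4)
  -- surjectivity from finiteness
  have hF : Function.Injective (e.symm ∘ fun i ↦ ((φ (t i) * σ : G) : G ⧸ N)) := e.symm.injective.comp hinj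
  have hFb := Finite.injective_iff_bijective.mp hF
  have : (fun i ↦ ((φ (t i) * σ : G) : G ⧸ N)) = e ∘ (e.symm ∘ fun i ↦ ((φ (t i) * σ : G) : G ⧸ N)) := by
    funext i; simp
  rw [this]
  exact e.bijective.comp hFb

/-- **Torsion inside an admissible module is `2^M`-divisible there** (`M ≥ 1`): an element of finite order in a
subgroup `A` without `2^M`-torsion has odd order `r`, and `u r + v 2^M = 1`. [cite: GrossLMS1991, Lemma 4.3] -/
theorem exists_zsmul_eq_of_isOfFinAddOrder_of_admissible {M₀ : Type*} [AddCommGroup M₀] {A : AddSubgroup M₀}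
    {M : ℕ} (hM : 1 ≤ M) (hA : ∀ a ∈ A, (((2 ^ M : ℕ) : ℤ)) • a = 0 → a = 0) {T : M₀} (hTA : T ∈ A)
    (hT : IsOfFinAddOrder T) : ∃ R ∈ A, T = (((2 ^ M : ℕ) : ℤ)) • R := by
  set r := addOrderOf T with hrdef
  have hr := hT.addOrderOf_pos
  have hrT : (r : ℤ) • T = 0 := by rw [natCast_zsmul, addOrderOf_nsmul_eq_zero]
  have hrodd : Odd r := by
    rcases Nat.even_or_odd r with ⟨k, hk⟩ | hodd
    · exfalso
      have hk0 : 0 < k := by omega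
      have hkT : k • T ≠ 0 := fun h0 ↦ by
        have := addOrderOf_le_of_nsmul_eq_zero hk0 h0; omega
      have h2k : (2 : ℕ) • (k • T) = 0 := by
        rw [← mul_nsmul, show k * 2 = r by omega]; exact addOrderOf_nsmul_eq_zero T
      apply hkT
      refine hA _ (A.nsmul_mem hTA k) ?_
      obtain ⟨M', rfl⟩ : ∃ M', M = M' + 1 := ⟨M - 1, by omega⟩
      rw [natCast_zsmul, pow_succ, mul_comm, mul_nsmul, h2k, nsmul_zero]
    · exact hodd
  obtain ⟨k, hk⟩ := hrodd
  have hcop : IsCoprime (r : ℤ) ((2 : ℤ) ^ M) := by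
    have h2 : IsCoprime (r : ℤ) 2 := ⟨1, -(k : ℤ), by push_cast [hk]; ring⟩
    exact h2.pow_right
  obtain ⟨u, v, huv⟩ := hcop
  refine ⟨v • T, A.zsmul_mem hTA v, ?_⟩
  calc T = (u * r + v * 2 ^ M) • T := by rw [huv, one_smul]
    _ = u • ((r : ℤ) • T) + (((2 ^ M : ℕ) : ℤ)) • (v • T) := by
        rw [add_smul, mul_smul, mul_comm v, mul_smul]; push_cast; rfl
    _ = (((2 ^ M : ℕ) : ℤ)) • (v • T) := by rw [hrT, smul_zero, zero_add]

end Group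

end Summit.BirchSwinnertonDyer.BirchSwinnertonDyer.Theorems.SylvesterTwoCMFlip

end
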